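import Summits.BirchSwinnertonDyer.BirchSwinnertonDyer.Theorems.ManinLocalTwoThreeShimuraIndexOddProfile
import HarnessLib

/-!
# The Shimura index at an odd prime: the `ℓ = 3` level profile, the unique split prime, and «the odd support of `[Λ₀:Λ₁]` is one prime»
# (cell bsd-f2-manin, es g43 ROAD γ; MEMO-es §66.7)

Cell bsd-f2-manin, seat es (planner), gen 43.  Typed rows over tree declarations; every row is an `@[conjecture] def … : Prop` and all four are
THEOREMS, closed by name below from `Theorems/ManinLocalTwoThreeShimuraIndexOddProfile.lean` (`ShimuraSieve.level_profile_three`,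
`ShimuraSieve.exists_split_prime_three`, `ShimuraSieve.exists_split_prime_of_not_sq_dvd`, `ShimuraSieve.odd_support_subsingleton`).  `¬ ShimuraIndexPrimeTo ℓ f` = «`ℓ ∣ [Λ₀(f):Λ₁(f)]`».
* E-es-231 `ShimuraThreeLevelProfile` — the C3-side companion of E-es-226: a `3` in the Shimura index lives on `N = 3^e · q^δ · ∏ pᵢ` with `e ≠ 1`,
  `q ≡ 1 (mod 3)` split (sign `−1`), `pᵢ ≡ 2 (mod 3)` non-split (sign `+1`);
* E-es-234 `ShimuraThreeSplitPrime` — `9 ∤ N`: squarefree level, exactly one split prime `q ≡ 1 (mod 3)`, the rest `≡ 2 (mod 3)` non-split;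
* E-es-232 `ShimuraOddUniqueSplitPrime` — for an odd `ℓ ∣ [Λ₀:Λ₁]` with `ℓ² ∤ N`: exactly one split prime `q ∣ N`, `q ≡ 1 (mod ℓ)`, all other
  primes of `N` non-split `≡ −1 (mod ℓ)` (THEOREM AL's sign-`−1` prime is multiplicative);
* E-es-233 `ShimuraIndexOddSupportPrimary` — for every `X₀(N)`-datum of a minimal curve (NO optimality hypothesis) at most ONE odd prime divides
  `[Λ₀(f):Λ₁(f)]` (support `⊆ {2,3,5}` by `shimuraIndexPrimeTo_of_seven_le_datum`; `3` and `5` are incompatible: the double sieve makes `N`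
  squarefree with `11 ∤ N`, ROAD β transported forces `11 ∣ N`).
Census = BC5 witness (HOME/es/E15-LATTICE-INDEX-v1.tsv 0f2795b49f3ad4a5, 1025 optimal classes, `N ≤ 19870`; HOME/es/g43/E231-odd-profile-check-g43.txt):
`3 ∣ n` at 23 classes — profile E-es-231 23/23, unique split prime `≡ 1 (3)` at the 21 classes with `9 ∤ N` (27a1, 54a1 have `9 ∣ N` and no
split prime); odd part of `n` ∈ {1, 3, 5} at 1025/1025 (`15 ∤ n`; max `n = 5`).  BSD is not proved here; C2/C3 untouched.
[cite: LingOesterle1991, Thm. 3 and Thm. 6] [cite: AtkinLehner1970, Thm. 3] [cite: ByeonKim2014, Prop. 4.1] [cite: Vatsal2005, Rem. 1.8]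
-/

set_option autoImplicit false

noncomputable section

open scoped MatrixGroups ModularForm

open CongruenceSubgroup Complex WeierstrassCurve Literature.NumberTheory.EllipticCurves
  Literature.NumberTheory.EllipticCurves.ModularForms
open Summit.BirchSwinnertonDyer.Rank1Residual.ManinAdditive Summit.BirchSwinnertonDyer.Rank1Residual.ManinAdditive.KatoCurve
open Summit.BirchSwinnertonDyer.BirchSwinnertonDyer.Theorems.ManinLocalTwoThree

namespace Summit.BirchSwinnertonDyer.Rank1Residual.ManinAdditive.EsG43

/-- **E-es-231 `ShimuraThreeLevelProfile`** (THEOREM: `shimuraThreeLevelProfile_holds`).  A `3` in `[Λ₀(f):Λ₁(f)]` (any newform `f` of level `N`)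
puts every prime `p ∣ N` in one of: `p = 3` with `9 ∣ N`; `p ∥ N` split, `p ≡ 1 (mod 3)`, Atkin–Lehner sign `−1`; `p ∥ N` non-split,
`p ≡ 2 (mod 3)`, sign `+1`. [cite: LingOesterle1991, Thm. 6] [cite: AtkinLehner1970, Thm. 3] -/
@[conjecture]
def ShimuraThreeLevelProfile : Prop :=
  ∀ (N : ℕ) [NeZero N] (f : CuspForm (Gamma0 N) 2), IsNewform0 f → ¬ ShimuraIndexPrimeTo 3 f → ∀ p : ℕ, p.Prime → p ∣ N →
    (p = 3 ∧ 9 ∣ N) ∨ (¬ p ^ 2 ∣ N ∧ cuspCoeff f p = 1 ∧ p % 3 = 1 ∧ atkinLehnerEigenvalueAt f p = -1) ∨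
      (¬ p ^ 2 ∣ N ∧ cuspCoeff f p = -1 ∧ p % 3 = 2 ∧ atkinLehnerEigenvalueAt f p = 1)

/-- **E-es-232 `ShimuraOddUniqueSplitPrime`** (THEOREM: `shimuraOddUniqueSplitPrime_holds`).  For an odd prime `ℓ ∣ [Λ₀(f):Λ₁(f)]` with `ℓ² ∤ N`
there is a split prime `q ∣ N` (`a_q(f) = +1`, `ℓ ∣ q − 1`) and every other prime of `N` is non-split with `ℓ ∣ p + 1`.
[cite: ByeonKim2014, Prop. 4.1] [cite: LingOesterle1991, Thm. 3 and Thm. 6] -/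
@[conjecture]
def ShimuraOddUniqueSplitPrime : Prop :=
  ∀ (N : ℕ) [NeZero N] (f : CuspForm (Gamma0 N) 2), IsNewform0 f → ∀ ℓ : ℕ, ℓ.Prime → ℓ ≠ 2 → ¬ ShimuraIndexPrimeTo ℓ f →
    ¬ ℓ ^ 2 ∣ N → ∃ q : ℕ, q.Prime ∧ q ∣ N ∧ cuspCoeff f q = 1 ∧ (ℓ : ℤ) ∣ (q : ℤ) - 1 ∧
      ∀ p : ℕ, p.Prime → p ∣ N → p ≠ q → (cuspCoeff f p = -1 ∧ (ℓ : ℤ) ∣ (p : ℤ) + 1)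

/-- **E-es-233 `ShimuraIndexOddSupportPrimary`** (THEOREM: `shimuraIndexOddSupportPrimary_holds`; NO optimality hypothesis).  For every
`X₀(N)`-datum `D` of a minimal curve at most one odd prime divides `[Λ₀(f):Λ₁(f)]` — with the tree's support bound `{2,3,5}`: the odd part of the
Shimura exponent is a power of `3` or a power of `5`. [cite: LingOesterle1991, Thm. 6] [cite: Vatsal2005, Rem. 1.8] [cite: ByeonKim2014, Thm. 1.1] -/
@[conjecture]
def ShimuraIndexOddSupportPrimary : Prop :=
  ∀ (W : WeierstrassCurve ℚ) [W.IsElliptic] [W.IsGloballyMinimal] {N : ℕ} [NeZero N] (D : ModularParametrizationData W N)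
    (ℓ₁ ℓ₂ : ℕ), ℓ₁.Prime → ℓ₂.Prime → ℓ₁ ≠ 2 → ℓ₂ ≠ 2 → ¬ ShimuraIndexPrimeTo ℓ₁ D.f → ¬ ShimuraIndexPrimeTo ℓ₂ D.f → ℓ₁ = ℓ₂

/-- **E-es-234 `ShimuraThreeSplitPrime`** (THEOREM: `shimuraThreeSplitPrime_holds`).  `3 ∣ [Λ₀(f):Λ₁(f)]` and `9 ∤ N`: the level is squarefree
with exactly one split prime `q ≡ 1 (mod 3)`; every other prime of `N` is `≡ 2 (mod 3)` and non-split.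
[cite: ByeonKim2014, Prop. 4.1] [cite: LingOesterle1991, Thm. 3 and Thm. 6] -/
@[conjecture]
def ShimuraThreeSplitPrime : Prop :=
  ∀ (N : ℕ) [NeZero N] (f : CuspForm (Gamma0 N) 2), IsNewform0 f → ¬ ShimuraIndexPrimeTo 3 f → ¬ 9 ∣ N →
    Squarefree N ∧ ∃ q : ℕ, q.Prime ∧ q ∣ N ∧ q % 3 = 1 ∧ cuspCoeff f q = 1 ∧
      ∀ p : ℕ, p.Prime → p ∣ N → p ≠ q → (p % 3 = 2 ∧ cuspCoeff f p = -1)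

/-- E-es-231 is a theorem. -/
theorem shimuraThreeLevelProfile_holds : ShimuraThreeLevelProfile :=
  fun _ _ _ hf hS _ hp hpN ↦ ShimuraSieve.level_profile_three hf hS hp hpN

/-- E-es-234 is a theorem. -/
theorem shimuraThreeSplitPrime_holds : ShimuraThreeSplitPrime :=
  fun _ _ _ hf hS h9 ↦ ShimuraSieve.exists_split_prime_three hf hS h9

/-- E-es-232 is a theorem. -/
theorem shimuraOddUniqueSplitPrime_holds : ShimuraOddUniqueSplitPrime := by
  intro N _ f hf ℓ hℓ hℓ2 hS hℓN
  obtain ⟨q, hq, hqN, -, haq, hd, hrest⟩ := ShimuraSieve.exists_split_prime_of_not_sq_dvd hf hℓ hℓ2 hS hℓN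
  exact ⟨q, hq, hqN, haq, hd, fun p hp hpN hpq ↦ ((hrest p hp hpN hpq).2)⟩

/-- E-es-233 is a theorem. -/
theorem shimuraIndexOddSupportPrimary_holds : ShimuraIndexOddSupportPrimary := by
  intro W _ _ N _ D ℓ₁ ℓ₂ h₁ h₂ h₁2 h₂2 hS₁ hS₂
  by_contra hne
  exact ShimuraSieve.odd_support_subsingleton W D h₁ h₂ h₁2 h₂2 hne hS₁ hS₂

end Summit.BirchSwinnertonDyer.Rank1Residual.ManinAdditive.EsG43

end
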